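import Summits.AnomalousDissipation.AnomalousDissipation.Theorems.SolenoidalFractalHomogenisationLagrangianStepLabelSplit
import HarnessLib

/-!
# K1L_D (stmt-AnomalousDissipation-27980), stub `stub_cellInputs` (registry v9 candidate): V2-level glue from the PROVIDER-SIZED PARTS §9a–§9d
# (split v29) to the (Zin)/(Recin) blocks of §9 — `zin_of_parts`, `recin_mono`, label-class facts (helper; `--supports … --as helper`; lead g3)

Split v29 of `Cruxes/LagrangianRenormalisationStep/Lines/onelevel_S23_split.lean` cuts the cell-side operator inputs §9 of `stub_windowFactsH` into
four provider-sized texts over CANONICAL pieces of the low-label window error `e = P(Uu − Tu)`: the slow block `PS(U − T)PS u = e_d + e_c` (§9a),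
the leak `e_l = PS(U − T)(u − PS u)` (§9b), the fast/corrector part `e_f = (P − PS)(U − T)u` (§9c), and the transfer bounds (§9d); `PS` = the
frequency projector of the slow-low set `S`, `P` = the label projector of the low-label class `A ⊇ S`.  THIS FILE is the Hilbert-space half of
the glue `cellInputs_of_parts`: `zin_of_parts` (the four canonical pieces recombine to `e` by linearity, have the right supports, and each
part's bound at its own small scale `η• ≤ ηz` gives the (Zin) bound at `ηz`), `recin_mono` (the (Recin) bounds are monotone in `(ηz, ε)`), and the
three facts about the low-label class `A = {k : ∃ z, |k − n z|² ≤ R²}` the glue needs (symmetry, `|k|² ≤ R² ⇒ k ∈ A`, `k ∉ A ⇒ |k|² > R²`).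
NOT a proof of any part, of the stub, of the crux, or of AD; rung F-D1.A0.
-/

set_option linter.dupNamespace false

noncomputable section

namespace Summit.AnomalousDissipation.AnomalousDissipation.Theorems.SolenoidalFractalHomogenisation.LagrangianStep

open Literature.Analysis Literature.Analysis.FunctionSpaces
open MeasureTheory Set Filter UnitAddTorus
open scoped ENNReal NNReal InnerProductSpace Classical
open OneLevelSplit

/-! ## The low-label class -/

/-- The low-label class `{k : ∃ z, |k − n•z|² ≤ R²}` is symmetric. -/
theorem mem_labelClass_neg_iff (n : ℤ) (R : ℝ) (k : Fin 3 → ℤ) :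
    k ∈ {k' : Fin 3 → ℤ | ∃ z : Fin 3 → ℤ, Torus.freqNormSq (k' - n • z) ≤ R ^ 2}
      ↔ -k ∈ {k' : Fin 3 → ℤ | ∃ z : Fin 3 → ℤ, Torus.freqNormSq (k' - n • z) ≤ R ^ 2} := by
  simp only [Set.mem_setOf_eq]
  constructor
  · rintro ⟨z, hz⟩
    refine ⟨-z, ?_⟩
    rw [show -k - n • -z = -(k - n • z) by rw [smul_neg, neg_sub_neg, neg_sub], Torus.freqNormSq_neg]
    exact hz
  · rintro ⟨z, hz⟩
    refine ⟨-z, ?_⟩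
    rw [show k - n • -z = -(-k - n • z) by rw [smul_neg, sub_neg_eq_add, neg_sub, sub_neg_eq_add, add_comm],
      Torus.freqNormSq_neg]
    exact hz

/-- Frequencies of norm `≤ R` have low label (`z = 0`). -/
theorem mem_labelClass_of_freqNormSq_le (n : ℤ) {R : ℝ} {k : Fin 3 → ℤ} (hk : Torus.freqNormSq k ≤ R ^ 2) :
    k ∈ {k' : Fin 3 → ℤ | ∃ z : Fin 3 → ℤ, Torus.freqNormSq (k' - n • z) ≤ R ^ 2} :=
  ⟨0, by rw [smul_zero, sub_zero]; exact hk⟩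

/-- Frequencies outside the low-label class have norm `> R`. -/
theorem freqNormSq_gt_of_not_mem_labelClass (n : ℤ) {R : ℝ} {k : Fin 3 → ℤ}
    (hk : k ∉ {k' : Fin 3 → ℤ | ∃ z : Fin 3 → ℤ, Torus.freqNormSq (k' - n • z) ≤ R ^ 2}) : R ^ 2 < Torus.freqNormSq k := by
  by_contra h
  exact hk (mem_labelClass_of_freqNormSq_le n (not_lt.1 h))

/-! ## (Recin) is monotone in the small scale and the slop -/

/-- The six transfer bounds at `(ηd, εd)` imply them at any `(ηz, ε) ≥ (ηd, εd)`. -/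
theorem recin_mono {D nx q1 q2 r1 r2 r3 r4 r5 r6 ηd ηz εd ε : ℝ} (hD : 0 ≤ D) (hnx : 0 ≤ nx) (hq1 : 0 ≤ q1) (hq2 : 0 ≤ q2)
    (hdz : ηd ≤ ηz) (hε : εd ≤ ε)
    (h1 : r1 ≤ Real.sqrt (ηd * D) + εd * nx) (h2 : r2 ≤ Real.sqrt (ηd * D) + εd * nx) (h3 : r3 ≤ ηd * q1 + εd * nx)
    (h4 : r4 ≤ ηd * q1 + εd * nx) (h5 : r5 ≤ ηd * q2 + εd * nx) (h6 : r6 ≤ 1 / 2 * q2 + εd * nx) :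
    r1 ≤ Real.sqrt (ηz * D) + ε * nx ∧ r2 ≤ Real.sqrt (ηz * D) + ε * nx ∧ r3 ≤ ηz * q1 + ε * nx ∧
      r4 ≤ ηz * q1 + ε * nx ∧ r5 ≤ ηz * q2 + ε * nx ∧ r6 ≤ 1 / 2 * q2 + ε * nx := by
  have hs : Real.sqrt (ηd * D) ≤ Real.sqrt (ηz * D) := Real.sqrt_le_sqrt (mul_le_mul_of_nonneg_right hdz hD)
  have hεx : εd * nx ≤ ε * nx := mul_le_mul_of_nonneg_right hε hnx
  have h1q : ηd * q1 ≤ ηz * q1 := mul_le_mul_of_nonneg_right hdz hq1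
  have h2q : ηd * q2 ≤ ηz * q2 := mul_le_mul_of_nonneg_right hdz hq2
  exact ⟨by linarith, by linarith, by linarith, by linarith, by linarith, by linarith⟩

/-! ## (Zin) from the three canonical parts -/

/-- **(Zin) from the parts.**  Slow block `PS(U − T)PS u = e_d + e_c` with the §9a bounds at scale `ηa`, leak bound (§9b) at `ηb` for
`e_l := PS(U − T)(u − PS u)`, fast bound (§9c) at `ηc` for `e_f := (P − PS)(U − T)u`, all `≤ ηz`: then `P(Uu − Tu) = e_d + e_c + e_l + e_f`
with the supports and the four (Zin) bounds of §9 at scale `ηz`.  `w ≥ 0` are the window weights (`min(1, rate_k τ)`), `S ⊆ A`. -/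
theorem zin_of_parts (S : Finset (Fin 3 → ℤ)) {A : Set (Fin 3 → ℤ)} (hSA : ∀ k, k ∈ S → k ∈ A) (T U P PS : V2 →L[ℝ] V2)
    (u e_d e_c : V2) (w : (Fin 3 → ℤ) → ℝ) {ηa ηb ηc ηz : ℝ}
    (hP : ∀ (y : V2) (k : Fin 3 → ℤ), mFourierCoeff (EuclideanSpace.complexify ∘ ⇑(P y)) k
      = if k ∈ A then mFourierCoeff (EuclideanSpace.complexify ∘ ⇑y) k else 0)
    (hPS : ∀ (y : V2) (k : Fin 3 → ℤ), mFourierCoeff (EuclideanSpace.complexify ∘ ⇑(PS y)) k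
      = if k ∈ S then mFourierCoeff (EuclideanSpace.complexify ∘ ⇑y) k else 0)
    (hw0 : ∀ k, 0 ≤ w k) (hb : 0 < ηb) (hc : 0 < ηc) (haz : ηa ≤ ηz) (hbz : ηb ≤ ηz) (hcz : ηc ≤ ηz)
    (hsplit : PS (U (PS u) - T (PS u)) = e_d + e_c)
    (hd_supp : ∀ k, k ∉ S → mFourierCoeff (EuclideanSpace.complexify ∘ ⇑e_d) k = 0)
    (hdiag : ∀ k, k ∈ S → ‖mFourierCoeff (EuclideanSpace.complexify ∘ ⇑e_d) k‖
      ≤ ηa * w k * ‖mFourierCoeff (EuclideanSpace.complexify ∘ ⇑u) k‖)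
    (hcross : ∀ y : V2, |⟪y, e_c⟫_ℝ| ≤ ηa
      * Real.sqrt (∑ k ∈ S, w k * ‖mFourierCoeff (EuclideanSpace.complexify ∘ ⇑u) k‖ ^ 2
          + (‖u‖ ^ 2 - ∑ k ∈ S, ‖mFourierCoeff (EuclideanSpace.complexify ∘ ⇑u) k‖ ^ 2))
      * Real.sqrt (∑ k ∈ S, w k * ‖mFourierCoeff (EuclideanSpace.complexify ∘ ⇑y) k‖ ^ 2
          + (‖y‖ ^ 2 - ∑ k ∈ S, ‖mFourierCoeff (EuclideanSpace.complexify ∘ ⇑y) k‖ ^ 2)))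
    (hleak : ∑ k ∈ S, ‖mFourierCoeff (EuclideanSpace.complexify ∘ ⇑(PS (U (u - PS u) - T (u - PS u)))) k‖ ^ 2 / (ηb ^ 2 * w k)
      ≤ ‖u‖ ^ 2 - ∑ k ∈ S, ‖mFourierCoeff (EuclideanSpace.complexify ∘ ⇑u) k‖ ^ 2)
    (hfast : ‖P (U u - T u) - PS (U u - T u)‖
      ≤ Real.sqrt (∑ k ∈ S, ηc ^ 2 * w k * ‖mFourierCoeff (EuclideanSpace.complexify ∘ ⇑u) k‖ ^ 2)
        + ηc * Real.sqrt (‖u‖ ^ 2 - ∑ k ∈ S, ‖mFourierCoeff (EuclideanSpace.complexify ∘ ⇑u) k‖ ^ 2)) :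
    ∃ e_d' e_c' e_l e_f : V2,
      P (U u - T u) = e_d' + e_c' + e_l + e_f ∧
      (∀ k, k ∉ S → mFourierCoeff (EuclideanSpace.complexify ∘ ⇑e_d') k = 0) ∧
      (∀ k, k ∉ S → mFourierCoeff (EuclideanSpace.complexify ∘ ⇑e_l) k = 0) ∧
      (∀ k, k ∈ S → mFourierCoeff (EuclideanSpace.complexify ∘ ⇑e_f) k = 0) ∧
      (∀ k, k ∈ S → ‖mFourierCoeff (EuclideanSpace.complexify ∘ ⇑e_d') k‖
        ≤ ηz * w k * ‖mFourierCoeff (EuclideanSpace.complexify ∘ ⇑u) k‖) ∧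
      (∀ y : V2, |⟪y, e_c'⟫_ℝ| ≤ ηz
        * Real.sqrt (∑ k ∈ S, w k * ‖mFourierCoeff (EuclideanSpace.complexify ∘ ⇑u) k‖ ^ 2
            + (‖u‖ ^ 2 - ∑ k ∈ S, ‖mFourierCoeff (EuclideanSpace.complexify ∘ ⇑u) k‖ ^ 2))
        * Real.sqrt (∑ k ∈ S, w k * ‖mFourierCoeff (EuclideanSpace.complexify ∘ ⇑y) k‖ ^ 2
            + (‖y‖ ^ 2 - ∑ k ∈ S, ‖mFourierCoeff (EuclideanSpace.complexify ∘ ⇑y) k‖ ^ 2))) ∧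
      (∑ k ∈ S, ‖mFourierCoeff (EuclideanSpace.complexify ∘ ⇑e_l) k‖ ^ 2 / (ηz ^ 2 * w k)
        ≤ ‖u‖ ^ 2 - ∑ k ∈ S, ‖mFourierCoeff (EuclideanSpace.complexify ∘ ⇑u) k‖ ^ 2) ∧
      ‖e_f‖ ≤ Real.sqrt (∑ k ∈ S, ηz ^ 2 * w k * ‖mFourierCoeff (EuclideanSpace.complexify ∘ ⇑u) k‖ ^ 2)
        + ηz * Real.sqrt (‖u‖ ^ 2 - ∑ k ∈ S, ‖mFourierCoeff (EuclideanSpace.complexify ∘ ⇑u) k‖ ^ 2) := by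
  refine ⟨e_d, e_c, PS (U (u - PS u) - T (u - PS u)), P (U u - T u) - PS (U u - T u), ?_, hd_supp, ?_, ?_, ?_, ?_, ?_, ?_⟩
  · -- recombination by linearity
    have hU : U (PS u) + U (u - PS u) = U u := by rw [← map_add, add_sub_cancel]
    have hT : T (PS u) + T (u - PS u) = T u := by rw [← map_add, add_sub_cancel]
    have hlin : PS (U (PS u) - T (PS u)) + PS (U (u - PS u) - T (u - PS u)) = PS (U u - T u) := by
      rw [← map_add, sub_add_sub_comm, hU, hT]
    rw [← hsplit, hlin]; abel
  · intro k hk; rw [hPS, if_neg hk]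
  · intro k hk; rw [fcoeff_sub, hP, hPS, if_pos (hSA k hk), if_pos hk, sub_self]
  · intro k hk
    exact (hdiag k hk).trans (mul_le_mul_of_nonneg_right (mul_le_mul_of_nonneg_right haz (hw0 k)) (norm_nonneg _))
  · intro y
    refine (hcross y).trans ?_
    have h1 := Real.sqrt_nonneg (∑ k ∈ S, w k * ‖mFourierCoeff (EuclideanSpace.complexify ∘ ⇑u) k‖ ^ 2
      + (‖u‖ ^ 2 - ∑ k ∈ S, ‖mFourierCoeff (EuclideanSpace.complexify ∘ ⇑u) k‖ ^ 2))
    have h2 := Real.sqrt_nonneg (∑ k ∈ S, w k * ‖mFourierCoeff (EuclideanSpace.complexify ∘ ⇑y) k‖ ^ 2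
      + (‖y‖ ^ 2 - ∑ k ∈ S, ‖mFourierCoeff (EuclideanSpace.complexify ∘ ⇑y) k‖ ^ 2))
    exact mul_le_mul_of_nonneg_right (mul_le_mul_of_nonneg_right haz h1) h2
  · refine le_trans (Finset.sum_le_sum fun k _ => ?_) hleak
    by_cases hk : w k = 0
    · simp [hk]
    · have hwk : 0 < w k := lt_of_le_of_ne (hw0 k) (Ne.symm hk)
      exact div_le_div_of_nonneg_left (sq_nonneg _) (mul_pos (pow_pos hb 2) hwk)
        (mul_le_mul_of_nonneg_right (pow_le_pow_left₀ hb.le hbz 2) hwk.le)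
  · refine hfast.trans (add_le_add (Real.sqrt_le_sqrt (Finset.sum_le_sum fun k _ => ?_)) ?_)
    · exact mul_le_mul_of_nonneg_right (mul_le_mul_of_nonneg_right (pow_le_pow_left₀ hc.le hcz 2) (hw0 k)) (sq_nonneg _)
    · exact mul_le_mul_of_nonneg_right hcz (Real.sqrt_nonneg _)

end Summit.AnomalousDissipation.AnomalousDissipation.Theorems.SolenoidalFractalHomogenisation.LagrangianStep
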